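import Literature.MathematicalPhysics.QuantumFieldTheory.Balaban1983to89.B6RandomWalkHom
import Literature.MathematicalPhysics.QuantumFieldTheory.Balaban1983to89.B9Thm34Inv

/-!
# `Balaban1983to89.B6RandomWalkSection` — [Balaban1984PropagatorsII] (2.51)–(2.55) p. 232, the block-majorant calculus, for letters
# read THROUGH A SECTION OF THE BLOCK MAP: a coarse carrier `Z` (e.g. the lattice 𝔅 of block labels, home of `(Q′G′²Q′*)⁻¹` in
# [Balaban1985BackgroundPropagators] (3.21)/(3.48)) embedded into the site carrier `X` along `rep : Z → X` with `blkX ∘ rep = blkZ`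
# (one representative site per block); block majorants are INVARIANT under this embedding, words are preserved (`rep* ∘ rep_! = id`),
# and the KERNEL form `|T(y,y′)| ≦ A·w(y)(L^{j′}η)^{−d}e^{−δd(y,y′)}` of (3.48)/(3.66)/(3.67) on 𝔅 IS a block majorant `A·w(y)e^{−δd}` over
# the identity block map — the typing dictionary between the cell's two models of the coarse-lattice letters (gen 6's 𝔅-carrier with
# kernels, `B9Thm34Inv`/`B9Ineq366CPrime`/`B9Ineq366Vprime`; gens 9–12's site-endomorphism letters, `B9Ineq368Vprime` … `B9Thm34GConcrete`)

statement-level skeleton of published theorems with citation tags; proofs where landed; nothing here is a claim about the Yang–Mills mass gap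

DOCFIX (cell `lit-balaban`, seat r06 gen 15, 2026-08-22; p37 `CITELOC-SWEEP-B4B9.md` §2b page-numeral slips, text layer re-read): (3.19) is p. 393 [PDF 5] ((3.20)–(3.25) p. 394); (3.57) is p. 401 [PDF 13] ((3.58)–(3.65) p. 402, (3.65)bis–(3.68) p. 403) — the locators of (3.19), (3.57) in this file corrected accordingly (9 place(s)); declarations, statements and proofs byte-identical to the tree copy of record (p315457).

CITATION HEADER (lean-in-tree rule).  [4] = T. Bałaban, *Propagators and renormalization transformations for lattice gauge theories. II*,
Commun. Math. Phys. **96** (1984) 223–250 [Balaban1984PropagatorsII] (cell paper B6; journal page = PDF page + 222): (2.51)–(2.55) p. 232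
«|(Tλ)(x)| ≦ K(y, y′)|λ|, x ∈ Bʲ(y), supp λ ⊂ B^{j′}(y′)» / «this property is preserved under the composition of operators possessing it».
B9 = T. Bałaban, *Propagators for lattice gauge theories in a background field*, CMP **99** (1985) 389–434 [Balaban1985BackgroundPropagators]
(journal page = PDF page + 388): (3.19) p. 393 (the averaging operators `Q′_j` from site functions to functions on the block lattice), (3.21)/(3.25)
p. 394 (`(Q′G′²Q′*)⁻¹` on the block lattice, `P(U) = G′Q′*(Q′G′²Q′*)⁻¹Q′G′`), Thm 3.2 (3.48) p. 398 («|(Q′(U)G′(U)²Q′*(U))⁻¹(y, y′)| ≦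
B₁(Lʲη)⁻⁴(L^{j′}η)^{−d}e^{−δ₁d(y,y′)} for y ∈ Λ_j, y′ ∈ Λ_{j′}» — the KERNEL convention with the volume factor `(L^{j′}η)^{−d}`), (3.66)/(3.67)
p. 403.  Cell `lit-balaban`, seat r06 (B9 fold owner) gen 12, FILE 17; SKELETON rows B9.Eq3.19 × B9.Eq3.25 × B9.Thm3.2 × B6 (2.51)–(2.55).
WHY: the Sect. B files of gens 9–12 (`B9Ineq368Vprime`, `B9Ineq349PConcrete`, `B9Thm34GConcrete`, `B9Thm34GEntries342`) type the
coarse-lattice letters `Q′, Q′*, F′₂, F′₂*, C⁻¹ = (Q′G′²Q′*)⁻¹, C⁻¹(U′U), C′(A)` as endomorphisms of the SITE carrier with block majorants,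
while gen 6 (`B9Thm34Inv.inverse_satisfies_thm32`, `B9Ineq366CPrime.inverse_satisfies_thm32_of_parts`, `B9Ineq366Vprime`) produces
`C⁻¹(U′U)` on the carrier 𝔅 = `g.Site` with kernel bounds.  This module is the bookkeeping that lets the latter feed the former; nothing
about B9's operators is asserted here.

WHAT THIS FILE PROVES (0 sorry; three definitions with bodies + theorems; [folklore] linear algebra, the cited displays are LOCATORS).
* §1 `secExt rep : (Z → ℝ) →ₗ[ℝ] (X → ℝ)` (extension by zero along `rep`), `secRes rep : (X → ℝ) →ₗ[ℝ] (Z → ℝ)` (restriction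
  `F ↦ F ∘ rep`), `secConj rep T := secExt rep ∘ₗ T ∘ₗ secRes rep` (a letter of 𝔅 read on the sites); for injective `rep`:
  `secExt_apply_rep`, `secRes_secExt_apply` / `secRes_comp_secExt` (`rep* ∘ rep_! = id`), `secConj_one`, `secConj_mul`, `secConj_add`,
  `secConj_sub`, `secConj_neg`, the word identities `comp_secRes_comp_secConj` (`(Qs ∘ rep*) ∘ (rep_! T rep*) = (Qs ∘ T) ∘ rep*`),
  `secConj_comp_secExt_comp`, **`word_secConj`** (`(Qs ∘ rep*) ∘ rep_! T rep* ∘ (rep_! ∘ Q) = Qs ∘ T ∘ Q` — the site-model word of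
  `P(U) = G′Q′*C⁻¹Q′G′` IS the two-space word), and the (3.67)-shape resolvent identity transported: `secConj_resolvent`.
* §2 majorants ([4] (2.51)): with `hrep : ∀ z, blkX (rep z) = blkZ z` — `blockSupp_secRes`, `blockSupp_secExt`, `hasMajorantHom_secRes` and
  `hasMajorantHom_secExt` (block-local, constant 1), **`hasMajorant_secConj`** (`T ≺ K` on `Z` ⟹ `rep_! T rep* ≺ K` on `X`),
  `hasMajorant_secExt_comp` (`Q : X → Z` two-space `≺ K` ⟹ `rep_! ∘ Q ≺ K`), `hasMajorant_comp_secRes` (`Qs : Z → X` ⟹ `Qs ∘ rep* ≺ K`).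
* §3 the kernel dictionary on 𝔅 (B9's `g.Site`, identity block map, volume `vol g d y = (Lʲη)^d` of `B9Thm34Inv`):
  **`hasMajorant_id_of_ker`** — `|ker (vol g d) T y y′| ≦ A·w(y)·(L^{j′}η)^{−d}·e(y,y′)` for all `y, y′` ⟹ `HasMajorant id T (A·w(y)·e(y,y′))`;
  and `hasMajorant_sites_of_ker` = §3 + §2 (`rep_! T rep* ≺ A·w·e` over `blkX` for any section `rep` of `blkX`).

HONEST SCOPE.  Pure typing/bookkeeping; the existence of a section (`rep` with `blkX ∘ rep = id`, i.e. every block contains a site) is a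
HYPOTHESIS wherever used; no B9 operator is constructed; no row head changes.

RELATED IN THE TREE, NOT DUPLICATED (searched 2026-08-22: `lean search 'secExt|secConj|RandomWalkSection|hasMajorant_id_of_ker'` = ∅):
`B6RandomWalkHom.emb/embL` and `B6RandomWalkBlocks.emb₄` embed letters into the functions on a DISJOINT UNION `X ⊕ Y` (a different
device: new carrier); `B9Thm34Inv.hasMajorant_id_iff` (entries ↔ majorant over the identity block map) and `ker_le_iff` are USED BY NAME.
-/

noncomputable section

namespace Literature.MathematicalPhysics.QuantumFieldTheory.Balaban1983to89.B6RandomWalkSection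

open Literature.MathematicalPhysics.QuantumFieldTheory.Balaban1983to89
open B6RandomWalk B6RandomWalkHom

/-! ## §1  The section letters `rep_!` (extension by zero), `rep*` (restriction) and `rep_! T rep*` -/

section Letters

variable {X Z : Type}

open Classical in
/-- **Extension by zero along `rep : Z → X`**: `(rep_! f)(x) = f(z)` if `x = rep z`, `= 0` off the range of `rep` (for injective `rep`,
`secExt_apply_rep`). [folklore] [cite: Balaban1985BackgroundPropagators, (3.19) p.393] -/
def secExt (rep : Z → X) : (Z → ℝ) →ₗ[ℝ] (X → ℝ) where
  toFun f x := if h : ∃ z, rep z = x then f h.choose else 0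
  map_add' _ _ := by
    funext x
    by_cases h : ∃ z, rep z = x <;> simp [h]
  map_smul' _ _ := by
    funext x
    by_cases h : ∃ z, rep z = x <;> simp [h]

/-- **Restriction along `rep`**: `(rep* F)(z) = F(rep z)`. [folklore] [cite: Balaban1985BackgroundPropagators, (3.19) p.393] -/
def secRes (rep : Z → X) : (X → ℝ) →ₗ[ℝ] (Z → ℝ) where
  toFun F z := F (rep z)
  map_add' _ _ := rfl
  map_smul' _ _ := rfl

/-- **A letter of the coarse carrier read on the sites**: `rep_! ∘ T ∘ rep*`. [folklore]
[cite: Balaban1985BackgroundPropagators, (3.25) p.394 + (3.48) p.398] -/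
def secConj (rep : Z → X) (T : Module.End ℝ (Z → ℝ)) : Module.End ℝ (X → ℝ) :=
  secExt rep ∘ₗ T ∘ₗ secRes rep

/-- Unfolding `secRes`. [folklore] [cite: Balaban1984PropagatorsII, (2.51)–(2.52) p.232] -/
@[simp] theorem secRes_apply (rep : Z → X) (F : X → ℝ) (z : Z) : secRes rep F z = F (rep z) := rfl

/-- Unfolding `secConj`. [folklore] [cite: Balaban1984PropagatorsII, (2.51)–(2.52) p.232] -/
theorem secConj_def (rep : Z → X) (T : Module.End ℝ (Z → ℝ)) : secConj rep T = secExt rep ∘ₗ T ∘ₗ secRes rep := rfl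

/-- Off the range of `rep` the extension vanishes. [folklore] [cite: Balaban1984PropagatorsII, (2.51)–(2.52) p.232] -/
theorem secExt_apply_of_forall_ne (rep : Z → X) (f : Z → ℝ) {x : X} (hx : ∀ z, rep z ≠ x) : secExt rep f x = 0 := by
  classical
  show (if h : ∃ z, rep z = x then f h.choose else 0) = 0
  rw [dif_neg (not_exists.mpr hx)]

/-- On the range of an injective `rep` the extension is the given function. [folklore] [cite: Balaban1984PropagatorsII, (2.51)–(2.52) p.232] -/
theorem secExt_apply_rep {rep : Z → X} (hinj : Function.Injective rep) (f : Z → ℝ) (z : Z) : secExt rep f (rep z) = f z := by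
  classical
  show (if h : ∃ z', rep z' = rep z then f h.choose else 0) = f z
  have h : ∃ z', rep z' = rep z := ⟨z, rfl⟩
  rw [dif_pos h, hinj h.choose_spec]

/-- Pointwise bound of the extension: `|(rep_! f)(x)| ≦ |f z|` if `x = rep z` (injective `rep`), else `0`. [folklore] [cite: Balaban1984PropagatorsII, (2.51)–(2.52) p.232] -/
theorem abs_secExt_apply_le (rep : Z → X) (f : Z → ℝ) (x : X) {B : ℝ} (hB : 0 ≤ B)
    (h : ∀ z, rep z = x → |f z| ≤ B) : |secExt rep f x| ≤ B := by
  classical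
  show |(if h : ∃ z, rep z = x then f h.choose else 0)| ≤ B
  split_ifs with hx
  · exact h _ hx.choose_spec
  · simpa using hB

/-- `rep* ∘ rep_! = id` for injective `rep`, pointwise. [folklore] [cite: Balaban1984PropagatorsII, (2.51)–(2.52) p.232] -/
theorem secRes_secExt_apply {rep : Z → X} (hinj : Function.Injective rep) (f : Z → ℝ) : secRes rep (secExt rep f) = f :=
  funext fun z => by rw [secRes_apply, secExt_apply_rep hinj]

/-- `rep* ∘ rep_! = id` for injective `rep`. [folklore] [cite: Balaban1984PropagatorsII, (2.51)–(2.52) p.232] -/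
theorem secRes_comp_secExt {rep : Z → X} (hinj : Function.Injective rep) : secRes rep ∘ₗ secExt rep = LinearMap.id :=
  LinearMap.ext fun f => secRes_secExt_apply hinj f

/-- `rep_! 1 rep* ` acts as the identity on the range: `(rep_! rep*) ∘ rep_! = rep_!`. [folklore] [cite: Balaban1984PropagatorsII, (2.51)–(2.52) p.232] -/
theorem secConj_one_comp_secExt {rep : Z → X} (hinj : Function.Injective rep) :
    secConj rep 1 ∘ₗ secExt rep = secExt rep := by
  refine LinearMap.ext fun f => ?_
  simp only [secConj, LinearMap.comp_apply, Module.End.one_apply, secRes_secExt_apply hinj]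

/-- Multiplicativity: `rep_! (T₁T₂) rep* = (rep_! T₁ rep*)(rep_! T₂ rep*)` for injective `rep`. [folklore]
[cite: Balaban1984PropagatorsII, (2.52) p.232] -/
theorem secConj_mul {rep : Z → X} (hinj : Function.Injective rep) (T₁ T₂ : Module.End ℝ (Z → ℝ)) :
    secConj rep (T₁ * T₂) = secConj rep T₁ * secConj rep T₂ := by
  refine LinearMap.ext fun F => ?_
  simp only [secConj, Module.End.mul_apply, LinearMap.comp_apply, secRes_secExt_apply hinj]

/-- Additivity of `rep_! · rep*`. [folklore] [cite: Balaban1984PropagatorsII, (2.51)–(2.52) p.232] -/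
theorem secConj_add (rep : Z → X) (T₁ T₂ : Module.End ℝ (Z → ℝ)) :
    secConj rep (T₁ + T₂) = secConj rep T₁ + secConj rep T₂ := by
  simp only [secConj, LinearMap.add_comp, LinearMap.comp_add]

/-- `rep_! (−T) rep* = −(rep_! T rep*)`. [folklore] [cite: Balaban1984PropagatorsII, (2.51)–(2.52) p.232] -/
theorem secConj_neg (rep : Z → X) (T : Module.End ℝ (Z → ℝ)) : secConj rep (-T) = -secConj rep T := by
  simp only [secConj, LinearMap.neg_comp, LinearMap.comp_neg]

/-- `rep_! (T₁ − T₂) rep* = rep_! T₁ rep* − rep_! T₂ rep*`. [folklore] [cite: Balaban1984PropagatorsII, (2.51)–(2.52) p.232] -/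
theorem secConj_sub (rep : Z → X) (T₁ T₂ : Module.End ℝ (Z → ℝ)) :
    secConj rep (T₁ - T₂) = secConj rep T₁ - secConj rep T₂ := by
  simp only [secConj, LinearMap.sub_comp, LinearMap.comp_sub]

/-- **The (3.67)-shape resolvent identity transported**: `T′ − T = −T′C′T` on the coarse carrier ⟹ the same for the letters read on
the sites (the hypothesis `hCC` of `B9Thm34GConcrete.thm34_G_entries13_allConcrete`). [folklore]
[cite: Balaban1985BackgroundPropagators, (3.67) p.403] -/
theorem secConj_resolvent {rep : Z → X} (hinj : Function.Injective rep) {T T' Cp : Module.End ℝ (Z → ℝ)}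
    (h : T' - T = -(T' * Cp * T)) :
    secConj rep T' - secConj rep T = -(secConj rep T' * secConj rep Cp * secConj rep T) := by
  rw [← secConj_sub, h, secConj_neg, secConj_mul hinj, secConj_mul hinj]

variable {W : Type}

/-- Word identity, right end: `(Qs ∘ rep*) ∘ (rep_! T rep*) = (Qs ∘ T) ∘ rep*`. [folklore] [cite: Balaban1984PropagatorsII, (2.52) p.232] -/
theorem comp_secRes_comp_secConj {rep : Z → X} (hinj : Function.Injective rep) (Qs : (Z → ℝ) →ₗ[ℝ] (W → ℝ))
    (T : Module.End ℝ (Z → ℝ)) :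
    (Qs ∘ₗ secRes rep) ∘ₗ secConj rep T = (Qs ∘ₗ T) ∘ₗ secRes rep := by
  refine LinearMap.ext fun F => ?_
  simp only [secConj, LinearMap.comp_apply, secRes_secExt_apply hinj]

/-- Word identity, left end: `(rep_! T rep*) ∘ (rep_! ∘ Q) = rep_! ∘ (T ∘ Q)`. [folklore] [cite: Balaban1984PropagatorsII, (2.52) p.232] -/
theorem secConj_comp_secExt_comp {rep : Z → X} (hinj : Function.Injective rep) (T : Module.End ℝ (Z → ℝ))
    (Q : (W → ℝ) →ₗ[ℝ] (Z → ℝ)) :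
    secConj rep T ∘ₗ (secExt rep ∘ₗ Q) = secExt rep ∘ₗ (T ∘ₗ Q) := by
  refine LinearMap.ext fun F => ?_
  simp only [secConj, LinearMap.comp_apply, secRes_secExt_apply hinj]

/-- **The site-model word IS the two-space word**: `(Qs ∘ rep*) ∘ (rep_! T rep*) ∘ (rep_! ∘ Q) = Qs ∘ T ∘ Q` — e.g. with `Qs = G′Q′*`,
`T = (Q′G′²Q′*)⁻¹`, `Q = Q′G′` this is `P(U) = G′Q′*(Q′G′²Q′*)⁻¹Q′G′` of (3.25) computed through the letters read on the sites.
[folklore] [cite: Balaban1985BackgroundPropagators, (3.25) p.394; Balaban1984PropagatorsII, (2.52) p.232] -/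
theorem word_secConj {rep : Z → X} (hinj : Function.Injective rep) {V : Type} (Qs : (Z → ℝ) →ₗ[ℝ] (W → ℝ))
    (T : Module.End ℝ (Z → ℝ)) (Q : (V → ℝ) →ₗ[ℝ] (Z → ℝ)) :
    (Qs ∘ₗ secRes rep) ∘ₗ secConj rep T ∘ₗ (secExt rep ∘ₗ Q) = Qs ∘ₗ T ∘ₗ Q := by
  refine LinearMap.ext fun F => ?_
  simp only [secConj, LinearMap.comp_apply, secRes_secExt_apply hinj]

/-- `rep_! (Q + F) = rep_! Q + rep_! F` as composites ((3.57) `Q′(U′U) = Q′(U) + F′₂(A)` read on the sites). [folklore]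
[cite: Balaban1985BackgroundPropagators, (3.57) p.401] -/
theorem secExt_comp_add (rep : Z → X) (Q F : (W → ℝ) →ₗ[ℝ] (Z → ℝ)) :
    secExt rep ∘ₗ (Q + F) = secExt rep ∘ₗ Q + secExt rep ∘ₗ F :=
  LinearMap.comp_add _ _ _

/-- `(Qs + Fs) ∘ rep* = Qs ∘ rep* + Fs ∘ rep*`. [folklore] [cite: Balaban1985BackgroundPropagators, (3.57) p.401] -/
theorem add_comp_secRes (rep : Z → X) (Qs Fs : (Z → ℝ) →ₗ[ℝ] (W → ℝ)) :
    (Qs + Fs) ∘ₗ secRes rep = Qs ∘ₗ secRes rep + Fs ∘ₗ secRes rep :=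
  LinearMap.add_comp _ _ _

end Letters

/-! ## §2  Block majorants through the section ([4] (2.51)) -/

section Majorants

variable {g : B6.Geometry} {X Z W : Type}

/-- Restriction along a section preserves block support. [folklore] [cite: Balaban1984PropagatorsII, (2.51) p.232] -/
theorem blockSupp_secRes {blkX : X → g.Site} {blkZ : Z → g.Site} {rep : Z → X} (hrep : ∀ z, blkX (rep z) = blkZ z)
    {F : X → ℝ} {y' : g.Site} {B : ℝ} (hF : BlockSupp blkX F y' B) : BlockSupp blkZ (secRes rep F) y' B :=
  ⟨hF.nonneg, fun z hz => hF.bound (rep z) (by rw [hrep z, hz]), fun z hz => hF.off (rep z) (by rwa [hrep z])⟩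

/-- Extension by zero along an injective section preserves block support. [folklore] [cite: Balaban1984PropagatorsII, (2.51) p.232] -/
theorem blockSupp_secExt {blkX : X → g.Site} {blkZ : Z → g.Site} {rep : Z → X} (hrep : ∀ z, blkX (rep z) = blkZ z)
    (hinj : Function.Injective rep) {f : Z → ℝ} {y' : g.Site} {B : ℝ} (hf : BlockSupp blkZ f y' B) :
    BlockSupp blkX (secExt rep f) y' B := by
  refine ⟨hf.nonneg, fun x hx => abs_secExt_apply_le rep f x hf.nonneg fun z hz => hf.bound z ?_, fun x hx => ?_⟩
  · rw [← hrep z, hz, hx]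
  · by_cases h : ∃ z, rep z = x
    · obtain ⟨z, rfl⟩ := h
      rw [secExt_apply_rep hinj]
      exact hf.off z (by rwa [← hrep z])
    · exact secExt_apply_of_forall_ne rep f (not_exists.mp h)

/-- `rep*` is block-local with constant `1`. [folklore] [cite: Balaban1984PropagatorsII, (2.51) p.232] -/
theorem hasMajorantHom_secRes [DecidableEq g.Site] {blkX : X → g.Site} {blkZ : Z → g.Site} {rep : Z → X}
    (hrep : ∀ z, blkX (rep z) = blkZ z) :
    HasMajorantHom blkX blkZ (secRes rep) (fun a b : g.Site => if a = b then 1 else 0) := by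
  intro y' F B hF z
  rw [secRes_apply]
  by_cases h : blkZ z = y'
  · simp only [if_pos h, one_mul]
    exact hF.bound (rep z) (by rw [hrep z, h])
  · simp only [if_neg h, zero_mul, hF.off (rep z) (by rwa [hrep z]), abs_zero, le_refl]

/-- `rep_!` is block-local with constant `1` (injective `rep`). [folklore] [cite: Balaban1984PropagatorsII, (2.51) p.232] -/
theorem hasMajorantHom_secExt [DecidableEq g.Site] {blkX : X → g.Site} {blkZ : Z → g.Site} {rep : Z → X}
    (hrep : ∀ z, blkX (rep z) = blkZ z) (hinj : Function.Injective rep) :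
    HasMajorantHom blkZ blkX (secExt rep) (fun a b : g.Site => if a = b then 1 else 0) := by
  intro y' f B hf x
  have hs := blockSupp_secExt hrep hinj hf
  by_cases h : blkX x = y'
  · simp only [if_pos h, one_mul]
    exact hs.bound x h
  · simp only [if_neg h, zero_mul, hs.off x h, abs_zero, le_refl]

/-- **A letter of the coarse carrier keeps its block majorant when read on the sites**: `T ≺ K` over `blkZ`, `K ≧ 0` ⟹
`rep_! T rep* ≺ K` over `blkX`. [folklore] [cite: Balaban1984PropagatorsII, (2.51)–(2.52) p.232; Balaban1985BackgroundPropagators, (3.48) p.398] -/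
theorem hasMajorant_secConj {blkX : X → g.Site} {blkZ : Z → g.Site} {rep : Z → X} (hrep : ∀ z, blkX (rep z) = blkZ z)
    {T : Module.End ℝ (Z → ℝ)} {K : g.Site → g.Site → ℝ} (hK : ∀ a b, 0 ≤ K a b)
    (hT : HasMajorant blkZ T K) : HasMajorant blkX (secConj rep T) K := by
  intro y' F B hF x
  have hν : ∀ z, |T (secRes rep F) z| ≤ K (blkZ z) y' * B := hT y' _ B (blockSupp_secRes hrep hF)
  show |secExt rep (T (secRes rep F)) x| ≤ K (blkX x) y' * B
  refine abs_secExt_apply_le rep _ x (mul_nonneg (hK _ _) hF.nonneg) fun z hz => ?_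
  rw [← hz, hrep z]
  exact hν z

/-- A two-space letter INTO the coarse carrier, read on the sites: `Q ≺ K` (`W → Z`) ⟹ `rep_! ∘ Q ≺ K` (`W → X`). [folklore]
[cite: Balaban1984PropagatorsII, (2.51) p.232; Balaban1985BackgroundPropagators, (3.19) p.393] -/
theorem hasMajorantHom_secExt_comp {blkX : X → g.Site} {blkZ : Z → g.Site} {blkW : W → g.Site} {rep : Z → X}
    (hrep : ∀ z, blkX (rep z) = blkZ z) {Q : (W → ℝ) →ₗ[ℝ] (Z → ℝ)} {K : g.Site → g.Site → ℝ}
    (hK : ∀ a b, 0 ≤ K a b) (hQ : HasMajorantHom blkW blkZ Q K) : HasMajorantHom blkW blkX (secExt rep ∘ₗ Q) K := by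
  intro y' F B hF x
  rw [LinearMap.comp_apply]
  refine abs_secExt_apply_le rep _ x (mul_nonneg (hK _ _) hF.nonneg) fun z hz => ?_
  rw [← hz, hrep z]
  exact hQ y' F B hF z

/-- A two-space letter OUT OF the coarse carrier, read on the sites: `Qs ≺ K` (`Z → W`) ⟹ `Qs ∘ rep* ≺ K` (`X → W`). [folklore]
[cite: Balaban1984PropagatorsII, (2.51) p.232; Balaban1985BackgroundPropagators, (3.19) p.393] -/
theorem hasMajorantHom_comp_secRes {blkX : X → g.Site} {blkZ : Z → g.Site} {blkW : W → g.Site} {rep : Z → X}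
    (hrep : ∀ z, blkX (rep z) = blkZ z) {Qs : (Z → ℝ) →ₗ[ℝ] (W → ℝ)} {K : g.Site → g.Site → ℝ}
    (hQs : HasMajorantHom blkZ blkW Qs K) : HasMajorantHom blkX blkW (Qs ∘ₗ secRes rep) K :=
  fun y' F B hF w => hQs y' (secRes rep F) B (blockSupp_secRes hrep hF) w

/-- One-space forms for `W = X` (the shapes `hQp`/`hQps` of `B9Thm34GConcrete`): `rep_! ∘ Q′ ≺ K` and `Q′* ∘ rep* ≺ K` as site
endomorphisms. [folklore] [cite: Balaban1985BackgroundPropagators, (3.19) p.393] -/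
theorem hasMajorant_secExt_comp {blkX : X → g.Site} {blkZ : Z → g.Site} {rep : Z → X} (hrep : ∀ z, blkX (rep z) = blkZ z)
    {Q : (X → ℝ) →ₗ[ℝ] (Z → ℝ)} {K : g.Site → g.Site → ℝ} (hK : ∀ a b, 0 ≤ K a b) (hQ : HasMajorantHom blkX blkZ Q K) :
    HasMajorant blkX (secExt rep ∘ₗ Q) K :=
  (hasMajorantHom_iff blkX _ K).mp (hasMajorantHom_secExt_comp hrep hK hQ)

/-- See `hasMajorant_secExt_comp`. [folklore] [cite: Balaban1985BackgroundPropagators, (3.19) p.393] -/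
theorem hasMajorant_comp_secRes {blkX : X → g.Site} {blkZ : Z → g.Site} {rep : Z → X} (hrep : ∀ z, blkX (rep z) = blkZ z)
    {Qs : (Z → ℝ) →ₗ[ℝ] (X → ℝ)} {K : g.Site → g.Site → ℝ} (hQs : HasMajorantHom blkZ blkX Qs K) :
    HasMajorant blkX (Qs ∘ₗ secRes rep) K :=
  (hasMajorantHom_iff blkX _ K).mp (hasMajorantHom_comp_secRes hrep hQs)

end Majorants

/-! ## §3  The kernel dictionary on 𝔅: (3.48)/(3.66)/(3.67)-shape kernel bounds ARE block majorants over the identity block map -/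

section Kernel

variable {g : B9.Geometry} [Fintype g.Site] [DecidableEq g.Site] {R : ℝ} {H : Prop}

/-- **Kernel form ⟹ majorant form on 𝔅**: if `|ker (vol g d) T y y′| ≦ A·w(y)·(L^{j′}η)^{−d}·e(y,y′)` for all `y, y′` (the convention of
(3.48): `(Tf)(y) = Σ_{y′}(L^{j′}η)^d T(y,y′)f(y′)`), then `T` has the block majorant `A·w(y)·e(y,y′)` over the identity block map of 𝔅
(`B9Thm34Inv.hasMajorant_id_iff`: the entries of `T` are `|T(y,y′)|(L^{j′}η)^d`). [folklore]
[cite: Balaban1985BackgroundPropagators, Thm 3.2 (3.48) p.398; Balaban1984PropagatorsII, (2.51) p.232] -/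
theorem hasMajorant_id_of_ker (d : ℕ) (hlen : ∀ y : g.Site, 0 < g.len y) (A : ℝ) (w : g.Site → ℝ)
    (e : g.Site → g.Site → ℝ) {T : Module.End ℝ (g.Site → ℝ)}
    (hT : ∀ y y' : g.Site, |B9Thm34Inv.ker (B9Thm34Inv.vol g d) T y y'| ≤ A * w y * g.len y' ^ (-(d : ℝ)) * e y y') :
    HasMajorant (g := B9Thm34Ext.toB6 g R H) (fun y : g.Site => y) T (fun y y' => A * w y * e y y') := by
  rw [B9Thm34Inv.hasMajorant_id_iff (R := R) (H := H)]
  intro y y'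
  have hv := B9Thm34Inv.vol_pos d hlen y'
  rw [← B9Thm34Inv.ker_le_iff (B9Thm34Inv.vol g d) hv T y (A * w y * e y y')]
  calc |B9Thm34Inv.ker (B9Thm34Inv.vol g d) T y y'| ≤ A * w y * g.len y' ^ (-(d : ℝ)) * e y y' := hT y y'
    _ = A * w y * e y y' * (B9Thm34Inv.vol g d y')⁻¹ := by rw [B9Thm34Inv.vol_inv d hlen]; ring

/-- **Kernel form on 𝔅 ⟹ majorant of the letter read on the sites**: §3 + `hasMajorant_secConj` — for a section `rep` of `blkX`
(`blkX ∘ rep = id`), `|ker (vol g d) T y y′| ≦ A·w(y)(L^{j′}η)^{−d}e(y,y′)` with `A·w·e ≧ 0` ⟹ `rep_! T rep* ≺ A·w(y)·e(y,y′)` over `blkX` —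
the shape in which (3.48) for `C⁻¹ = (Q′G′²Q′*)⁻¹`, `C⁻¹(U′U)` (`B9Ineq366CPrime.inverse_satisfies_thm32_of_parts`) enter
`B9Thm34GConcrete` (`hCinv`, `hCinv'`). [folklore] [cite: Balaban1985BackgroundPropagators, Thm 3.2 (3.48) p.398 + (3.25) p.394; Balaban1984PropagatorsII, (2.51) p.232] -/
theorem hasMajorant_sites_of_ker {X : Type} (blkX : X → g.Site) {rep : g.Site → X} (hrep : ∀ y, blkX (rep y) = y) (d : ℕ)
    (hlen : ∀ y : g.Site, 0 < g.len y) (A : ℝ) (w : g.Site → ℝ) (e : g.Site → g.Site → ℝ)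
    (hAwe : ∀ y y', 0 ≤ A * w y * e y y') {T : Module.End ℝ (g.Site → ℝ)}
    (hT : ∀ y y' : g.Site, |B9Thm34Inv.ker (B9Thm34Inv.vol g d) T y y'| ≤ A * w y * g.len y' ^ (-(d : ℝ)) * e y y') :
    HasMajorant (g := B9Thm34Ext.toB6 g R H) blkX (secConj rep T) (fun y y' => A * w y * e y y') :=
  hasMajorant_secConj (g := B9Thm34Ext.toB6 g R H) (blkZ := fun y : g.Site => y) hrep hAwe
    (hasMajorant_id_of_ker (R := R) (H := H) d hlen A w e hT)

end Kernel

end Literature.MathematicalPhysics.QuantumFieldTheory.Balaban1983to89.B6RandomWalkSection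

end
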